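import Summits.ValiantsHypothesis.ValiantsHypothesis.Theorems.KPlusLogSqLawTridiagonalRealStaticPumpEven

/-!
# Route «KPlusLogSqLaw», crux `WeakLifting` (stmt-ValiantsHypothesis-19561) — REAL side of the tridiagonal sector:
# THE PUMP FROM AN ARBITRARY SEED, part 1 (mechanics) — one move from ANY state of lift-p1's 17-clause pump invariant, `j` moves from a seed,
# and the harvest from any state (part 2, `…PumpSeedRow`: the rows «seed `(m₀, S)` ⇒ `B m ≥ 2m + S − 2m₀` for all `m > m₀`» in the typed currency)

HONEST FRAMING.  Helper (`--supports stmt-ValiantsHypothesis-19561 --as helper`), seat val-sym-lift-p3 (g15), cell `pub-symmetroid`,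
2026-08-28, in the continuant / typed currencies of the pump files (`…PumpStep`, `…PumpIter`, `…PumpHarvestPos/Neg`, `…PumpEven`, seat
val-sym-lift-p1 g12) and of the desk's α target of record (`staticTridiagonal_definite_posRoots_le`, lead R2102/R2114).  LOWER side only,
pure bookkeeping: NO new design, NO located zero, NO new seed.  The tree's `pump_iter` bundles the base state `(D₃, D₄)` (`|R| + |T| = 1`,
size `4`) with the induction, and `pump_iter_parity` repeats the whole induction to track the orientation; neither lets a DIFFERENT base be fed
in.  This file factors the induction step out of `pump_iter` VERBATIM (same two realised moves `pump_move_I` / `pump_move_II`, same abstract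
`pump_step`) and re-assembles the pump from an arbitrary seed:
* `pump_succ` — ONE MOVE FROM ANY STATE: if vertex exponents `e`, links `(b, f)`, an orientation `ρ = ±1`, signs `s`, `μ = −ρs` and sample data
  `P0 < x < x₁ < R < M < T < y < y₁ < P1` (actual points `ρ·z > 0`) satisfy the 17 clauses for `(z ↦ D_{k+3}(ρz), z ↦ D_{k+4}(ρz))` with
  `|R| + |T| = S`, then one hierarchical edge (type I if `ρ = 1`, type II if `ρ = −1`) gives data satisfying the 17 clauses for
  `(D_{k+4}, D_{k+5})` with orientation `−ρ` and `|R'| + |T'| = S + 2`;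
* `pump_moves` — `j` moves: orientation `(−1)^j ρ`, `|R| + |T| = S + 2j`, sizes `(k+j+3, k+j+4)` (recovers `pump_iter` AND `pump_iter_parity`
  from the base `pump_base₀`: `k = 0`, `S = 1`, `ρ = −1`);
* `harvest_of_state` — the harvest edge from any state: a strictly increasing list of `≥ S + 3` positive points (`≥ S + 4` when `ρ = 1`, the
  transition zero at the junction, `pump_harvest_pos₄`) along which `D_{k+5}` alternates;
* `exists_typed_of_alternation` — packaging of `(e, b, f, Λ)` as a matrix `of (fun i j => C (c i j) * X ^ (e i j))` of the typed currency
  (`c`, `e` symmetric, `c = 0` off the band, diagonal coefficients `1`), any size;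
* `row_of_seed` / `row_of_seed_pos` — **THE SEEDED PUMP**: from a certified seed `(k, S, ρ)` as above, for every `j` a STATIC DEFINITE symmetric
  tridiagonal `(k+j+5) × (k+j+5)` monomial matrix with at least `S + 2j + 2` distinct positive determinant zeros, and at least `S + 2j + 3` when
  `(−1)^j ρ = 1`; `le_law_of_seed` / `le_law_of_seed_pos` — the same against any admissible law `B` of the sector.
ACCOUNTING (val-sym-lift-p3 g14 memo GLUE-AND-SEEDS §3, now kernel): a seed of size `m₀ = k + 4` with invariant value `S` gives
`B m ≥ 2m + S − 2m₀` for every `m > m₀` (one more at every other size).  The only seed in the tree is the pump's own base (`m₀ = 4`, `S = 1`: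
`2m − 7` / `2m − 6`); a seed with `S = 2m₀ − 5` (root word `q p^r q^t p`, `r + t = 2m₀ − 3`, plus the sign clause) would give `2m − 5` / `2m − 4`
for all larger `m` through `row_of_seed` with no further analysis — none is claimed here (located census of this seat: no kernel design of the
α column is such a seed; best ties `S = 2m₀ − 7`).  Nothing here is an UPPER bound; nothing bears on `WeakLifting` / `TropicalB` (stmt-19771) in
their windows, on Conjecture B, on the Door-A registers, on `MatrixDescartes` (stmt-ValiantsHypothesis-18050) or on VP ≠ VNP.
[mechanism: val-sym-lift-p3 g9's pump-and-harvest as kernelised by val-sym-lift-p1 g12; folklore analysis and continuants]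
-/

-- `Summit.ValiantsHypothesis.ValiantsHypothesis.…` repeats a component by the D-0017 layout (single-conjunct summit); the name is mandated.
set_option linter.dupNamespace false
set_option autoImplicit false

namespace Summit.ValiantsHypothesis.ValiantsHypothesis.Theorems.KPlusLogSqLaw.StaticTridiagonalRealLadder

open Polynomial
open Summit.ValiantsHypothesis.ValiantsHypothesis.Theorems.ValuativeFlip (ctK ctPath ctPath_apply ctK_zero ctK_one ctK_add_two)

/-! ### One move from an arbitrary state -/

/-- **ONE PUMP MOVE FROM ANY STATE** (module docstring): the induction step of `pump_iter`, verbatim, with the state as hypotheses.  From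
the 17-clause invariant for `(z ↦ D_{k+3}(ρz), z ↦ D_{k+4}(ρz))` with orientation `ρ = ±1`, `μ = −ρs`, positive actual points and
`|R| + |T| = S`, one hierarchical edge (type I: vertex `X⁰`, link `√κ·X^f`, if `ρ = 1`; type II: vertex `X^L`, link `√κ·X⁰`, if `ρ = −1`)
extending the data above size `k + 4` yields the invariant for `(D_{k+4}, D_{k+5})` with orientation `−ρ` and `|R'| + |T'| = S + 2`.
[mechanism: val-sym-lift-p3 g9's pump; kernel step of val-sym-lift-p1 g12's `pump_iter`, factored out] -/
theorem pump_succ (k S : ℕ) {e : ℕ → ℕ} {b : ℕ → ℝ} {f : ℕ → ℕ} {ρ s μ P0 x x₁ : ℝ} {R : List ℝ} {M : ℝ} {T : List ℝ} {y y₁ P1 : ℝ}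
    (hρ : ρ = 1 ∨ ρ = -1) (hμ : μ = -(ρ * s)) (hρP0 : 0 < ρ * P0) (hρP1 : 0 < ρ * P1) (hlen : R.length + T.length = S)
    (c1 : (P0 :: x :: x₁ :: (R ++ M :: (T ++ [y, y₁, P1]))).IsChain (· < ·))
    (c2a : 0 < s * (fun z : ℝ => (((ctPath (fun t => (X : ℝ[X]) ^ e t) (fun t => C (b t) * X ^ f t) (fun t => C (b (t - 1)) * X ^ f (t - 1)) (k + 4))).det).eval (ρ * z)) P0)
    (c2b : s * (fun z : ℝ => (((ctPath (fun t => (X : ℝ[X]) ^ e t) (fun t => C (b t) * X ^ f t) (fun t => C (b (t - 1)) * X ^ f (t - 1)) (k + 4))).det).eval (ρ * z)) x < 0)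
    (c2c : s * (fun z : ℝ => (((ctPath (fun t => (X : ℝ[X]) ^ e t) (fun t => C (b t) * X ^ f t) (fun t => C (b (t - 1)) * X ^ f (t - 1)) (k + 4))).det).eval (ρ * z)) x₁ < 0)
    (c2d : (∀ r ∈ R, s * (fun z : ℝ => (((ctPath (fun t => (X : ℝ[X]) ^ e t) (fun t => C (b t) * X ^ f t) (fun t => C (b (t - 1)) * X ^ f (t - 1)) (k + 4))).det).eval (ρ * z)) r < 0))
    (c2e : s * (fun z : ℝ => (((ctPath (fun t => (X : ℝ[X]) ^ e t) (fun t => C (b t) * X ^ f t) (fun t => C (b (t - 1)) * X ^ f (t - 1)) (k + 4))).det).eval (ρ * z)) M < 0)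
    (c2f : (M :: (T ++ [y])).IsChain (fun u v => (fun z : ℝ => (((ctPath (fun t => (X : ℝ[X]) ^ e t) (fun t => C (b t) * X ^ f t) (fun t => C (b (t - 1)) * X ^ f (t - 1)) (k + 4))).det).eval (ρ * z)) u * (fun z : ℝ => (((ctPath (fun t => (X : ℝ[X]) ^ e t) (fun t => C (b t) * X ^ f t) (fun t => C (b (t - 1)) * X ^ f (t - 1)) (k + 4))).det).eval (ρ * z)) v < 0))
    (c2g : μ * (fun z : ℝ => (((ctPath (fun t => (X : ℝ[X]) ^ e t) (fun t => C (b t) * X ^ f t) (fun t => C (b (t - 1)) * X ^ f (t - 1)) (k + 4))).det).eval (ρ * z)) y < 0)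
    (c3c : s * (fun z : ℝ => (((ctPath (fun t => (X : ℝ[X]) ^ e t) (fun t => C (b t) * X ^ f t) (fun t => C (b (t - 1)) * X ^ f (t - 1)) (k + 3))).det).eval (ρ * z)) x₁ < 0)
    (c3d : (x₁ :: (R ++ [M])).IsChain (fun u v => (fun z : ℝ => (((ctPath (fun t => (X : ℝ[X]) ^ e t) (fun t => C (b t) * X ^ f t) (fun t => C (b (t - 1)) * X ^ f (t - 1)) (k + 3))).det).eval (ρ * z)) u * (fun z : ℝ => (((ctPath (fun t => (X : ℝ[X]) ^ e t) (fun t => C (b t) * X ^ f t) (fun t => C (b (t - 1)) * X ^ f (t - 1)) (k + 3))).det).eval (ρ * z)) v < 0))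
    (c3e : 0 < μ * (fun z : ℝ => (((ctPath (fun t => (X : ℝ[X]) ^ e t) (fun t => C (b t) * X ^ f t) (fun t => C (b (t - 1)) * X ^ f (t - 1)) (k + 3))).det).eval (ρ * z)) M)
    (c3f : (∀ t ∈ T, 0 < μ * (fun z : ℝ => (((ctPath (fun t => (X : ℝ[X]) ^ e t) (fun t => C (b t) * X ^ f t) (fun t => C (b (t - 1)) * X ^ f (t - 1)) (k + 3))).det).eval (ρ * z)) t))
    (c3g : 0 < μ * (fun z : ℝ => (((ctPath (fun t => (X : ℝ[X]) ^ e t) (fun t => C (b t) * X ^ f t) (fun t => C (b (t - 1)) * X ^ f (t - 1)) (k + 3))).det).eval (ρ * z)) y)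
    (c3h : 0 < μ * (fun z : ℝ => (((ctPath (fun t => (X : ℝ[X]) ^ e t) (fun t => C (b t) * X ^ f t) (fun t => C (b (t - 1)) * X ^ f (t - 1)) (k + 3))).det).eval (ρ * z)) y₁)
    (c3i : μ * (fun z : ℝ => (((ctPath (fun t => (X : ℝ[X]) ^ e t) (fun t => C (b t) * X ^ f t) (fun t => C (b (t - 1)) * X ^ f (t - 1)) (k + 3))).det).eval (ρ * z)) P1 < 0)
    (c4 : (∀ z ∈ Set.Icc P0 x₁, s * (fun z : ℝ => (((ctPath (fun t => (X : ℝ[X]) ^ e t) (fun t => C (b t) * X ^ f t) (fun t => C (b (t - 1)) * X ^ f (t - 1)) (k + 3))).det).eval (ρ * z)) z < 0))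
    (c5 : (∀ z ∈ Set.Icc y P1, μ * (fun z : ℝ => (((ctPath (fun t => (X : ℝ[X]) ^ e t) (fun t => C (b t) * X ^ f t) (fun t => C (b (t - 1)) * X ^ f (t - 1)) (k + 4))).det).eval (ρ * z)) z < 0)) :
    ∃ (e' : ℕ → ℕ) (b' : ℕ → ℝ) (f' : ℕ → ℕ) (ρ' s' μ' P0' x' x₁' : ℝ) (R' : List ℝ) (M' : ℝ) (T' : List ℝ) (y' y₁' P1' : ℝ),
    ρ' = -ρ ∧ μ' = -(ρ' * s') ∧ 0 < ρ' * P0' ∧ 0 < ρ' * P1' ∧ R'.length + T'.length = S + 2 ∧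
    ((P0' :: x' :: x₁' :: (R' ++ M' :: (T' ++ [y', y₁', P1']))).IsChain (· < ·) ∧
    0 < s' * (fun z : ℝ => (((ctPath (fun t => (X : ℝ[X]) ^ e' t) (fun t => C (b' t) * X ^ f' t) (fun t => C (b' (t - 1)) * X ^ f' (t - 1)) (k + 5))).det).eval (ρ' * z)) P0' ∧
    s' * (fun z : ℝ => (((ctPath (fun t => (X : ℝ[X]) ^ e' t) (fun t => C (b' t) * X ^ f' t) (fun t => C (b' (t - 1)) * X ^ f' (t - 1)) (k + 5))).det).eval (ρ' * z)) x' < 0 ∧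
    s' * (fun z : ℝ => (((ctPath (fun t => (X : ℝ[X]) ^ e' t) (fun t => C (b' t) * X ^ f' t) (fun t => C (b' (t - 1)) * X ^ f' (t - 1)) (k + 5))).det).eval (ρ' * z)) x₁' < 0 ∧
    (∀ r ∈ R', s' * (fun z : ℝ => (((ctPath (fun t => (X : ℝ[X]) ^ e' t) (fun t => C (b' t) * X ^ f' t) (fun t => C (b' (t - 1)) * X ^ f' (t - 1)) (k + 5))).det).eval (ρ' * z)) r < 0) ∧
    s' * (fun z : ℝ => (((ctPath (fun t => (X : ℝ[X]) ^ e' t) (fun t => C (b' t) * X ^ f' t) (fun t => C (b' (t - 1)) * X ^ f' (t - 1)) (k + 5))).det).eval (ρ' * z)) M' < 0 ∧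
    (M' :: (T' ++ [y'])).IsChain (fun u v => (fun z : ℝ => (((ctPath (fun t => (X : ℝ[X]) ^ e' t) (fun t => C (b' t) * X ^ f' t) (fun t => C (b' (t - 1)) * X ^ f' (t - 1)) (k + 5))).det).eval (ρ' * z)) u * (fun z : ℝ => (((ctPath (fun t => (X : ℝ[X]) ^ e' t) (fun t => C (b' t) * X ^ f' t) (fun t => C (b' (t - 1)) * X ^ f' (t - 1)) (k + 5))).det).eval (ρ' * z)) v < 0) ∧
    μ' * (fun z : ℝ => (((ctPath (fun t => (X : ℝ[X]) ^ e' t) (fun t => C (b' t) * X ^ f' t) (fun t => C (b' (t - 1)) * X ^ f' (t - 1)) (k + 5))).det).eval (ρ' * z)) y' < 0 ∧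
    s' * (fun z : ℝ => (((ctPath (fun t => (X : ℝ[X]) ^ e' t) (fun t => C (b' t) * X ^ f' t) (fun t => C (b' (t - 1)) * X ^ f' (t - 1)) (k + 4))).det).eval (ρ' * z)) x₁' < 0 ∧
    (x₁' :: (R' ++ [M'])).IsChain (fun u v => (fun z : ℝ => (((ctPath (fun t => (X : ℝ[X]) ^ e' t) (fun t => C (b' t) * X ^ f' t) (fun t => C (b' (t - 1)) * X ^ f' (t - 1)) (k + 4))).det).eval (ρ' * z)) u * (fun z : ℝ => (((ctPath (fun t => (X : ℝ[X]) ^ e' t) (fun t => C (b' t) * X ^ f' t) (fun t => C (b' (t - 1)) * X ^ f' (t - 1)) (k + 4))).det).eval (ρ' * z)) v < 0) ∧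
    0 < μ' * (fun z : ℝ => (((ctPath (fun t => (X : ℝ[X]) ^ e' t) (fun t => C (b' t) * X ^ f' t) (fun t => C (b' (t - 1)) * X ^ f' (t - 1)) (k + 4))).det).eval (ρ' * z)) M' ∧
    (∀ t ∈ T', 0 < μ' * (fun z : ℝ => (((ctPath (fun t => (X : ℝ[X]) ^ e' t) (fun t => C (b' t) * X ^ f' t) (fun t => C (b' (t - 1)) * X ^ f' (t - 1)) (k + 4))).det).eval (ρ' * z)) t) ∧
    0 < μ' * (fun z : ℝ => (((ctPath (fun t => (X : ℝ[X]) ^ e' t) (fun t => C (b' t) * X ^ f' t) (fun t => C (b' (t - 1)) * X ^ f' (t - 1)) (k + 4))).det).eval (ρ' * z)) y' ∧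
    0 < μ' * (fun z : ℝ => (((ctPath (fun t => (X : ℝ[X]) ^ e' t) (fun t => C (b' t) * X ^ f' t) (fun t => C (b' (t - 1)) * X ^ f' (t - 1)) (k + 4))).det).eval (ρ' * z)) y₁' ∧
    μ' * (fun z : ℝ => (((ctPath (fun t => (X : ℝ[X]) ^ e' t) (fun t => C (b' t) * X ^ f' t) (fun t => C (b' (t - 1)) * X ^ f' (t - 1)) (k + 4))).det).eval (ρ' * z)) P1' < 0 ∧
    (∀ z ∈ Set.Icc P0' x₁', s' * (fun z : ℝ => (((ctPath (fun t => (X : ℝ[X]) ^ e' t) (fun t => C (b' t) * X ^ f' t) (fun t => C (b' (t - 1)) * X ^ f' (t - 1)) (k + 4))).det).eval (ρ' * z)) z < 0) ∧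
    (∀ z ∈ Set.Icc y' P1', μ' * (fun z : ℝ => (((ctPath (fun t => (X : ℝ[X]) ^ e' t) (fun t => C (b' t) * X ^ f' t) (fun t => C (b' (t - 1)) * X ^ f' (t - 1)) (k + 5))).det).eval (ρ' * z)) z < 0)) := by
  -- orderings
  have o1 : P0 < x := (List.isChain_cons_cons.mp c1).1
  have o2 : x < x₁ := (List.isChain_cons_cons.mp (List.isChain_cons_cons.mp c1).2).1
  have hP0P1 : P0 < P1 := lt_of_lt_of_le o1 (le_last_of_isChain c1 x (by simp))
  -- non-vanishing at the sample points
  have hG0 : (fun z : ℝ => (((ctPath (fun t => (X : ℝ[X]) ^ e t) (fun t => C (b t) * X ^ f t) (fun t => C (b (t - 1)) * X ^ f (t - 1)) (k + 4))).det).eval (ρ * z)) P0 ≠ 0 := by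
    intro h0; rw [h0, mul_zero] at c2a; exact lt_irrefl _ c2a
  have hGx : (fun z : ℝ => (((ctPath (fun t => (X : ℝ[X]) ^ e t) (fun t => C (b t) * X ^ f t) (fun t => C (b (t - 1)) * X ^ f (t - 1)) (k + 4))).det).eval (ρ * z)) x ≠ 0 := by
    intro h0; rw [h0, mul_zero] at c2b; exact lt_irrefl _ c2b
  have hF : ∀ P ∈ (x₁ :: (R ++ M :: (T ++ [y, y₁, P1]))), (fun z : ℝ => (((ctPath (fun t => (X : ℝ[X]) ^ e t) (fun t => C (b t) * X ^ f t) (fun t => C (b (t - 1)) * X ^ f (t - 1)) (k + 3))).det).eval (ρ * z)) P ≠ 0 := by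
    intro P hP
    simp only [List.mem_cons, List.mem_append, List.mem_nil_iff, or_false] at hP
    rcases hP with rfl | hP | rfl | hP | rfl | rfl | rfl
    · intro h0; rw [h0, mul_zero] at c3c; exact lt_irrefl _ c3c
    · exact ne_zero_of_isChain_alt₂ c3d (by simp) P (by simp [hP])
    · intro h0; rw [h0, mul_zero] at c3e; exact lt_irrefl _ c3e
    · intro h0; have := c3f P hP; rw [h0, mul_zero] at this; exact lt_irrefl _ this
    · intro h0; rw [h0, mul_zero] at c3g; exact lt_irrefl _ c3g
    · intro h0; rw [h0, mul_zero] at c3h; exact lt_irrefl _ c3h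
    · intro h0; rw [h0, mul_zero] at c3i; exact lt_irrefl _ c3i
  have hFc := continuous_eval_det_epath e b f (k + 3) ρ
  have hGc := continuous_eval_det_epath e b f (k + 4) ρ
  rcases hρ with rfl | rfl
  · ------------------------------------------------------------------ type I move (ρ = 1)
    have hP0 : 0 < P0 := by linarith
    obtain ⟨fe, κ, hκ, m1, m1', m2⟩ := pump_move_I (F := (fun z : ℝ => (((ctPath (fun t => (X : ℝ[X]) ^ e t) (fun t => C (b t) * X ^ f t) (fun t => C (b (t - 1)) * X ^ f (t - 1)) (k + 3))).det).eval (1 * z))) (G := (fun z : ℝ => (((ctPath (fun t => (X : ℝ[X]) ^ e t) (fun t => C (b t) * X ^ f t) (fun t => C (b (t - 1)) * X ^ f (t - 1)) (k + 4))).det).eval (1 * z)))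
      hP0 c1 hG0 hGx hF
    have hhc : Continuous (fun z : ℝ => (fun z : ℝ => (((ctPath (fun t => (X : ℝ[X]) ^ e t) (fun t => C (b t) * X ^ f t) (fun t => C (b (t - 1)) * X ^ f (t - 1)) (k + 4))).det).eval (1 * z)) z - κ * z ^ (2 * fe) * (fun z : ℝ => (((ctPath (fun t => (X : ℝ[X]) ^ e t) (fun t => C (b t) * X ^ f t) (fun t => C (b (t - 1)) * X ^ f (t - 1)) (k + 3))).det).eval (1 * z)) z) :=
      hGc.sub ((continuous_const.mul (continuous_id.pow _)).mul hFc)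
    obtain ⟨w₁, w, H⟩ := pump_step (f := (fun z : ℝ => (((ctPath (fun t => (X : ℝ[X]) ^ e t) (fun t => C (b t) * X ^ f t) (fun t => C (b (t - 1)) * X ^ f (t - 1)) (k + 3))).det).eval (1 * z))) (g := (fun z : ℝ => (((ctPath (fun t => (X : ℝ[X]) ^ e t) (fun t => C (b t) * X ^ f t) (fun t => C (b (t - 1)) * X ^ f (t - 1)) (k + 4))).det).eval (1 * z)))
      (h := fun z : ℝ => (fun z : ℝ => (((ctPath (fun t => (X : ℝ[X]) ^ e t) (fun t => C (b t) * X ^ f t) (fun t => C (b (t - 1)) * X ^ f (t - 1)) (k + 4))).det).eval (1 * z)) z - κ * z ^ (2 * fe) * (fun z : ℝ => (((ctPath (fun t => (X : ℝ[X]) ^ e t) (fun t => C (b t) * X ^ f t) (fun t => C (b (t - 1)) * X ^ f (t - 1)) (k + 3))).det).eval (1 * z)) z)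
      hGc hhc c1 c2a c2b c2c c2d c2e c2f c2g c3c c3d c3e c3f c3g c3h c3i c4 c5 m1 m1' m2
      (by
        intro z hz hz0
        have hzpos : 0 < z := hP0.trans_le hz.1
        refine ⟨1, κ * z ^ (2 * fe), one_pos, by positivity, ?_⟩
        have : (fun z : ℝ => (((ctPath (fun t => (X : ℝ[X]) ^ e t) (fun t => C (b t) * X ^ f t) (fun t => C (b (t - 1)) * X ^ f (t - 1)) (k + 4))).det).eval (1 * z)) z - κ * z ^ (2 * fe) * (fun z : ℝ => (((ctPath (fun t => (X : ℝ[X]) ^ e t) (fun t => C (b t) * X ^ f t) (fun t => C (b (t - 1)) * X ^ f (t - 1)) (k + 3))).det).eval (1 * z)) z = 0 := hz0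
        linarith)
    -- the extended data: vertex exponent 0, link (√κ, fe)
    obtain ⟨e', he'⟩ : ∃ e' : ℕ → ℕ, e' = fun t => if t < k + 4 then e t else 0 := ⟨_, rfl⟩
    obtain ⟨b', hb'⟩ : ∃ b' : ℕ → ℝ, b' = fun t => if t < k + 3 then b t else Real.sqrt κ := ⟨_, rfl⟩
    obtain ⟨f', hf'⟩ : ∃ f' : ℕ → ℕ, f' = fun t => if t < k + 3 then f t else fe := ⟨_, rfl⟩
    have hagree : ∀ n, n ≤ k + 4 → (ctPath (fun t => (X : ℝ[X]) ^ e' t) (fun t => C (b' t) * X ^ f' t) (fun t => C (b' (t - 1)) * X ^ f' (t - 1)) n) = (ctPath (fun t => (X : ℝ[X]) ^ e t) (fun t => C (b t) * X ^ f t) (fun t => C (b (t - 1)) * X ^ f (t - 1)) n) := by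
      intro n hn
      refine ctPath_congr_edata (fun t ht => ?_) (fun t ht => ?_) (fun t ht => ?_)
      · rw [he']; simp only [show t < k + 4 by omega, if_true]
      · rw [hb']; simp only [show t < k + 3 by omega, if_true]
      · rw [hf']; simp only [show t < k + 3 by omega, if_true]
    have hD3 : ∀ u : ℝ, (((ctPath (fun t => (X : ℝ[X]) ^ e' t) (fun t => C (b' t) * X ^ f' t) (fun t => C (b' (t - 1)) * X ^ f' (t - 1)) (k + 3))).det).eval u = (((ctPath (fun t => (X : ℝ[X]) ^ e t) (fun t => C (b t) * X ^ f t) (fun t => C (b (t - 1)) * X ^ f (t - 1)) (k + 3))).det).eval u := by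
      intro u; rw [hagree _ (by omega)]
    have hD4 : ∀ u : ℝ, (((ctPath (fun t => (X : ℝ[X]) ^ e' t) (fun t => C (b' t) * X ^ f' t) (fun t => C (b' (t - 1)) * X ^ f' (t - 1)) (k + 4))).det).eval u = (((ctPath (fun t => (X : ℝ[X]) ^ e t) (fun t => C (b t) * X ^ f t) (fun t => C (b (t - 1)) * X ^ f (t - 1)) (k + 4))).det).eval u := by
      intro u; rw [hagree _ (by omega)]
    have hD5 : ∀ u : ℝ, (((ctPath (fun t => (X : ℝ[X]) ^ e' t) (fun t => C (b' t) * X ^ f' t) (fun t => C (b' (t - 1)) * X ^ f' (t - 1)) (k + 5))).det).eval u =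
        (((ctPath (fun t => (X : ℝ[X]) ^ e t) (fun t => C (b t) * X ^ f t) (fun t => C (b (t - 1)) * X ^ f (t - 1)) (k + 4))).det).eval u - κ * u ^ (2 * fe) * (((ctPath (fun t => (X : ℝ[X]) ^ e t) (fun t => C (b t) * X ^ f t) (fun t => C (b (t - 1)) * X ^ f (t - 1)) (k + 3))).det).eval u := by
      intro u
      have h := eval_det_epath_add_two e' b' f' (k + 3) u
      have h1 : e' (k + 3 + 1) = 0 := by rw [he']; simp
      have h2 : b' (k + 3) ^ 2 = κ := by rw [hb']; simp only [lt_irrefl, if_false]; exact Real.sq_sqrt hκ.le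
      have h3 : f' (k + 3) = fe := by rw [hf']; simp
      have h4 : (((ctPath (fun t => (X : ℝ[X]) ^ e' t) (fun t => C (b' t) * X ^ f' t) (fun t => C (b' (t - 1)) * X ^ f' (t - 1)) (k + 3 + 1))).det).eval u = (((ctPath (fun t => (X : ℝ[X]) ^ e t) (fun t => C (b t) * X ^ f t) (fun t => C (b (t - 1)) * X ^ f (t - 1)) (k + 4))).det).eval u := by
        rw [hagree _ (by omega)]
      rw [h1, h2, h3, h4, hD3, pow_zero, one_mul] at h
      exact h
    refine ⟨e', b', f', -1, μ, -s, -P1, -y₁, -y, T.reverse.map (fun z : ℝ => -z), -M,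
      (x :: x₁ :: R).reverse.map (fun z : ℝ => -z), -w, -w₁, -P0, by norm_num, by rw [hμ]; ring, by linarith, by linarith,
      by simp; omega, ?_⟩
    simp only [hD4, hD5, one_mul, neg_mul, neg_neg, mul_neg] at H ⊢
    exact H
  · ------------------------------------------------------------------ type II move (ρ = −1)
    have hP1 : P1 < 0 := by linarith
    obtain ⟨L, κ, hκ, m1, m1', m2⟩ := pump_move_II (F := (fun z : ℝ => (((ctPath (fun t => (X : ℝ[X]) ^ e t) (fun t => C (b t) * X ^ f t) (fun t => C (b (t - 1)) * X ^ f (t - 1)) (k + 3))).det).eval ((-1) * z))) (G := (fun z : ℝ => (((ctPath (fun t => (X : ℝ[X]) ^ e t) (fun t => C (b t) * X ^ f t) (fun t => C (b (t - 1)) * X ^ f (t - 1)) (k + 4))).det).eval ((-1) * z)))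
      hP1 c1 hG0 hGx hF
    have hhc : Continuous (fun z : ℝ => (-z) ^ L * (fun z : ℝ => (((ctPath (fun t => (X : ℝ[X]) ^ e t) (fun t => C (b t) * X ^ f t) (fun t => C (b (t - 1)) * X ^ f (t - 1)) (k + 4))).det).eval ((-1) * z)) z - κ * (fun z : ℝ => (((ctPath (fun t => (X : ℝ[X]) ^ e t) (fun t => C (b t) * X ^ f t) (fun t => C (b (t - 1)) * X ^ f (t - 1)) (k + 3))).det).eval ((-1) * z)) z) :=
      ((continuous_neg.pow L).mul hGc).sub (continuous_const.mul hFc)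
    obtain ⟨w₁, w, H⟩ := pump_step (f := (fun z : ℝ => (((ctPath (fun t => (X : ℝ[X]) ^ e t) (fun t => C (b t) * X ^ f t) (fun t => C (b (t - 1)) * X ^ f (t - 1)) (k + 3))).det).eval ((-1) * z))) (g := (fun z : ℝ => (((ctPath (fun t => (X : ℝ[X]) ^ e t) (fun t => C (b t) * X ^ f t) (fun t => C (b (t - 1)) * X ^ f (t - 1)) (k + 4))).det).eval ((-1) * z)))
      (h := fun z : ℝ => (-z) ^ L * (fun z : ℝ => (((ctPath (fun t => (X : ℝ[X]) ^ e t) (fun t => C (b t) * X ^ f t) (fun t => C (b (t - 1)) * X ^ f (t - 1)) (k + 4))).det).eval ((-1) * z)) z - κ * (fun z : ℝ => (((ctPath (fun t => (X : ℝ[X]) ^ e t) (fun t => C (b t) * X ^ f t) (fun t => C (b (t - 1)) * X ^ f (t - 1)) (k + 3))).det).eval ((-1) * z)) z)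
      hGc hhc c1 c2a c2b c2c c2d c2e c2f c2g c3c c3d c3e c3f c3g c3h c3i c4 c5 m1 m1' m2
      (by
        intro z hz hz0
        have hzneg : 0 < -z := by linarith [hz.2, o2, le_last_of_isChain c1 x₁ (by simp)]
        refine ⟨(-z) ^ L, κ, by positivity, hκ, ?_⟩
        have : (-z) ^ L * (fun z : ℝ => (((ctPath (fun t => (X : ℝ[X]) ^ e t) (fun t => C (b t) * X ^ f t) (fun t => C (b (t - 1)) * X ^ f (t - 1)) (k + 4))).det).eval ((-1) * z)) z - κ * (fun z : ℝ => (((ctPath (fun t => (X : ℝ[X]) ^ e t) (fun t => C (b t) * X ^ f t) (fun t => C (b (t - 1)) * X ^ f (t - 1)) (k + 3))).det).eval ((-1) * z)) z = 0 := hz0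
        linarith)
    -- the extended data: vertex exponent L, link (√κ, 0)
    obtain ⟨e', he'⟩ : ∃ e' : ℕ → ℕ, e' = fun t => if t < k + 4 then e t else L := ⟨_, rfl⟩
    obtain ⟨b', hb'⟩ : ∃ b' : ℕ → ℝ, b' = fun t => if t < k + 3 then b t else Real.sqrt κ := ⟨_, rfl⟩
    obtain ⟨f', hf'⟩ : ∃ f' : ℕ → ℕ, f' = fun t => if t < k + 3 then f t else 0 := ⟨_, rfl⟩
    have hagree : ∀ n, n ≤ k + 4 → (ctPath (fun t => (X : ℝ[X]) ^ e' t) (fun t => C (b' t) * X ^ f' t) (fun t => C (b' (t - 1)) * X ^ f' (t - 1)) n) = (ctPath (fun t => (X : ℝ[X]) ^ e t) (fun t => C (b t) * X ^ f t) (fun t => C (b (t - 1)) * X ^ f (t - 1)) n) := by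
      intro n hn
      refine ctPath_congr_edata (fun t ht => ?_) (fun t ht => ?_) (fun t ht => ?_)
      · rw [he']; simp only [show t < k + 4 by omega, if_true]
      · rw [hb']; simp only [show t < k + 3 by omega, if_true]
      · rw [hf']; simp only [show t < k + 3 by omega, if_true]
    have hD3 : ∀ u : ℝ, (((ctPath (fun t => (X : ℝ[X]) ^ e' t) (fun t => C (b' t) * X ^ f' t) (fun t => C (b' (t - 1)) * X ^ f' (t - 1)) (k + 3))).det).eval u = (((ctPath (fun t => (X : ℝ[X]) ^ e t) (fun t => C (b t) * X ^ f t) (fun t => C (b (t - 1)) * X ^ f (t - 1)) (k + 3))).det).eval u := by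
      intro u; rw [hagree _ (by omega)]
    have hD4 : ∀ u : ℝ, (((ctPath (fun t => (X : ℝ[X]) ^ e' t) (fun t => C (b' t) * X ^ f' t) (fun t => C (b' (t - 1)) * X ^ f' (t - 1)) (k + 4))).det).eval u = (((ctPath (fun t => (X : ℝ[X]) ^ e t) (fun t => C (b t) * X ^ f t) (fun t => C (b (t - 1)) * X ^ f (t - 1)) (k + 4))).det).eval u := by
      intro u; rw [hagree _ (by omega)]
    have hD5 : ∀ u : ℝ, (((ctPath (fun t => (X : ℝ[X]) ^ e' t) (fun t => C (b' t) * X ^ f' t) (fun t => C (b' (t - 1)) * X ^ f' (t - 1)) (k + 5))).det).eval u =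
        u ^ L * (((ctPath (fun t => (X : ℝ[X]) ^ e t) (fun t => C (b t) * X ^ f t) (fun t => C (b (t - 1)) * X ^ f (t - 1)) (k + 4))).det).eval u - κ * (((ctPath (fun t => (X : ℝ[X]) ^ e t) (fun t => C (b t) * X ^ f t) (fun t => C (b (t - 1)) * X ^ f (t - 1)) (k + 3))).det).eval u := by
      intro u
      have h := eval_det_epath_add_two e' b' f' (k + 3) u
      have h1 : e' (k + 3 + 1) = L := by rw [he']; simp
      have h2 : b' (k + 3) ^ 2 = κ := by rw [hb']; simp only [lt_irrefl, if_false]; exact Real.sq_sqrt hκ.le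
      have h3 : f' (k + 3) = 0 := by rw [hf']; simp
      have h4 : (((ctPath (fun t => (X : ℝ[X]) ^ e' t) (fun t => C (b' t) * X ^ f' t) (fun t => C (b' (t - 1)) * X ^ f' (t - 1)) (k + 3 + 1))).det).eval u = (((ctPath (fun t => (X : ℝ[X]) ^ e t) (fun t => C (b t) * X ^ f t) (fun t => C (b (t - 1)) * X ^ f (t - 1)) (k + 4))).det).eval u := by
        rw [hagree _ (by omega)]
      rw [h1, h2, h3, h4, hD3, mul_zero, pow_zero, mul_one] at h
      exact h
    refine ⟨e', b', f', 1, μ, -s, -P1, -y₁, -y, T.reverse.map (fun z : ℝ => -z), -M,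
      (x :: x₁ :: R).reverse.map (fun z : ℝ => -z), -w, -w₁, -P0, by norm_num, by rw [hμ]; ring, by linarith, by linarith,
      by simp; omega, ?_⟩
    simp only [hD4, hD5, one_mul, neg_mul, neg_neg, mul_neg] at H ⊢
    exact H

/-! ### Iteration from a seed -/

/-- **`j` PUMP MOVES FROM A SEED**: from the 17-clause invariant at sizes `(k+3, k+4)` with orientation `ρ`, `μ = −ρs`, positive actual points
and `|R| + |T| = S`, after `j` moves the invariant holds at sizes `(k+j+3, k+j+4)` with orientation `(−1)^j ρ` and `|R| + |T| = S + 2j`.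
(With the base `pump_base₀` — `k = 0`, `S = 1`, `ρ = −1` — this is `pump_iter` / `pump_iter_parity`.) [mechanism: val-sym-lift-p3 g9's pump;
folklore] -/
theorem pump_moves (k S : ℕ) {e : ℕ → ℕ} {b : ℕ → ℝ} {f : ℕ → ℕ} {ρ s μ P0 x x₁ : ℝ} {R : List ℝ} {M : ℝ} {T : List ℝ} {y y₁ P1 : ℝ}
    (hρ : ρ = 1 ∨ ρ = -1) (hμ : μ = -(ρ * s)) (hρP0 : 0 < ρ * P0) (hρP1 : 0 < ρ * P1) (hlen : R.length + T.length = S)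
    (c1 : (P0 :: x :: x₁ :: (R ++ M :: (T ++ [y, y₁, P1]))).IsChain (· < ·))
    (c2a : 0 < s * (fun z : ℝ => (((ctPath (fun t => (X : ℝ[X]) ^ e t) (fun t => C (b t) * X ^ f t) (fun t => C (b (t - 1)) * X ^ f (t - 1)) (k + 4))).det).eval (ρ * z)) P0)
    (c2b : s * (fun z : ℝ => (((ctPath (fun t => (X : ℝ[X]) ^ e t) (fun t => C (b t) * X ^ f t) (fun t => C (b (t - 1)) * X ^ f (t - 1)) (k + 4))).det).eval (ρ * z)) x < 0)
    (c2c : s * (fun z : ℝ => (((ctPath (fun t => (X : ℝ[X]) ^ e t) (fun t => C (b t) * X ^ f t) (fun t => C (b (t - 1)) * X ^ f (t - 1)) (k + 4))).det).eval (ρ * z)) x₁ < 0)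
    (c2d : (∀ r ∈ R, s * (fun z : ℝ => (((ctPath (fun t => (X : ℝ[X]) ^ e t) (fun t => C (b t) * X ^ f t) (fun t => C (b (t - 1)) * X ^ f (t - 1)) (k + 4))).det).eval (ρ * z)) r < 0))
    (c2e : s * (fun z : ℝ => (((ctPath (fun t => (X : ℝ[X]) ^ e t) (fun t => C (b t) * X ^ f t) (fun t => C (b (t - 1)) * X ^ f (t - 1)) (k + 4))).det).eval (ρ * z)) M < 0)
    (c2f : (M :: (T ++ [y])).IsChain (fun u v => (fun z : ℝ => (((ctPath (fun t => (X : ℝ[X]) ^ e t) (fun t => C (b t) * X ^ f t) (fun t => C (b (t - 1)) * X ^ f (t - 1)) (k + 4))).det).eval (ρ * z)) u * (fun z : ℝ => (((ctPath (fun t => (X : ℝ[X]) ^ e t) (fun t => C (b t) * X ^ f t) (fun t => C (b (t - 1)) * X ^ f (t - 1)) (k + 4))).det).eval (ρ * z)) v < 0))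
    (c2g : μ * (fun z : ℝ => (((ctPath (fun t => (X : ℝ[X]) ^ e t) (fun t => C (b t) * X ^ f t) (fun t => C (b (t - 1)) * X ^ f (t - 1)) (k + 4))).det).eval (ρ * z)) y < 0)
    (c3c : s * (fun z : ℝ => (((ctPath (fun t => (X : ℝ[X]) ^ e t) (fun t => C (b t) * X ^ f t) (fun t => C (b (t - 1)) * X ^ f (t - 1)) (k + 3))).det).eval (ρ * z)) x₁ < 0)
    (c3d : (x₁ :: (R ++ [M])).IsChain (fun u v => (fun z : ℝ => (((ctPath (fun t => (X : ℝ[X]) ^ e t) (fun t => C (b t) * X ^ f t) (fun t => C (b (t - 1)) * X ^ f (t - 1)) (k + 3))).det).eval (ρ * z)) u * (fun z : ℝ => (((ctPath (fun t => (X : ℝ[X]) ^ e t) (fun t => C (b t) * X ^ f t) (fun t => C (b (t - 1)) * X ^ f (t - 1)) (k + 3))).det).eval (ρ * z)) v < 0))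
    (c3e : 0 < μ * (fun z : ℝ => (((ctPath (fun t => (X : ℝ[X]) ^ e t) (fun t => C (b t) * X ^ f t) (fun t => C (b (t - 1)) * X ^ f (t - 1)) (k + 3))).det).eval (ρ * z)) M)
    (c3f : (∀ t ∈ T, 0 < μ * (fun z : ℝ => (((ctPath (fun t => (X : ℝ[X]) ^ e t) (fun t => C (b t) * X ^ f t) (fun t => C (b (t - 1)) * X ^ f (t - 1)) (k + 3))).det).eval (ρ * z)) t))
    (c3g : 0 < μ * (fun z : ℝ => (((ctPath (fun t => (X : ℝ[X]) ^ e t) (fun t => C (b t) * X ^ f t) (fun t => C (b (t - 1)) * X ^ f (t - 1)) (k + 3))).det).eval (ρ * z)) y)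
    (c3h : 0 < μ * (fun z : ℝ => (((ctPath (fun t => (X : ℝ[X]) ^ e t) (fun t => C (b t) * X ^ f t) (fun t => C (b (t - 1)) * X ^ f (t - 1)) (k + 3))).det).eval (ρ * z)) y₁)
    (c3i : μ * (fun z : ℝ => (((ctPath (fun t => (X : ℝ[X]) ^ e t) (fun t => C (b t) * X ^ f t) (fun t => C (b (t - 1)) * X ^ f (t - 1)) (k + 3))).det).eval (ρ * z)) P1 < 0)
    (c4 : (∀ z ∈ Set.Icc P0 x₁, s * (fun z : ℝ => (((ctPath (fun t => (X : ℝ[X]) ^ e t) (fun t => C (b t) * X ^ f t) (fun t => C (b (t - 1)) * X ^ f (t - 1)) (k + 3))).det).eval (ρ * z)) z < 0))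
    (c5 : (∀ z ∈ Set.Icc y P1, μ * (fun z : ℝ => (((ctPath (fun t => (X : ℝ[X]) ^ e t) (fun t => C (b t) * X ^ f t) (fun t => C (b (t - 1)) * X ^ f (t - 1)) (k + 4))).det).eval (ρ * z)) z < 0)) (j : ℕ) :
    ∃ (e' : ℕ → ℕ) (b' : ℕ → ℝ) (f' : ℕ → ℕ) (ρ' s' μ' P0' x' x₁' : ℝ) (R' : List ℝ) (M' : ℝ) (T' : List ℝ) (y' y₁' P1' : ℝ),
    ρ' = (-1) ^ j * ρ ∧ μ' = -(ρ' * s') ∧ 0 < ρ' * P0' ∧ 0 < ρ' * P1' ∧ R'.length + T'.length = S + 2 * j ∧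
    ((P0' :: x' :: x₁' :: (R' ++ M' :: (T' ++ [y', y₁', P1']))).IsChain (· < ·) ∧
    0 < s' * (fun z : ℝ => (((ctPath (fun t => (X : ℝ[X]) ^ e' t) (fun t => C (b' t) * X ^ f' t) (fun t => C (b' (t - 1)) * X ^ f' (t - 1)) (k + j + 4))).det).eval (ρ' * z)) P0' ∧
    s' * (fun z : ℝ => (((ctPath (fun t => (X : ℝ[X]) ^ e' t) (fun t => C (b' t) * X ^ f' t) (fun t => C (b' (t - 1)) * X ^ f' (t - 1)) (k + j + 4))).det).eval (ρ' * z)) x' < 0 ∧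
    s' * (fun z : ℝ => (((ctPath (fun t => (X : ℝ[X]) ^ e' t) (fun t => C (b' t) * X ^ f' t) (fun t => C (b' (t - 1)) * X ^ f' (t - 1)) (k + j + 4))).det).eval (ρ' * z)) x₁' < 0 ∧
    (∀ r ∈ R', s' * (fun z : ℝ => (((ctPath (fun t => (X : ℝ[X]) ^ e' t) (fun t => C (b' t) * X ^ f' t) (fun t => C (b' (t - 1)) * X ^ f' (t - 1)) (k + j + 4))).det).eval (ρ' * z)) r < 0) ∧
    s' * (fun z : ℝ => (((ctPath (fun t => (X : ℝ[X]) ^ e' t) (fun t => C (b' t) * X ^ f' t) (fun t => C (b' (t - 1)) * X ^ f' (t - 1)) (k + j + 4))).det).eval (ρ' * z)) M' < 0 ∧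
    (M' :: (T' ++ [y'])).IsChain (fun u v => (fun z : ℝ => (((ctPath (fun t => (X : ℝ[X]) ^ e' t) (fun t => C (b' t) * X ^ f' t) (fun t => C (b' (t - 1)) * X ^ f' (t - 1)) (k + j + 4))).det).eval (ρ' * z)) u * (fun z : ℝ => (((ctPath (fun t => (X : ℝ[X]) ^ e' t) (fun t => C (b' t) * X ^ f' t) (fun t => C (b' (t - 1)) * X ^ f' (t - 1)) (k + j + 4))).det).eval (ρ' * z)) v < 0) ∧
    μ' * (fun z : ℝ => (((ctPath (fun t => (X : ℝ[X]) ^ e' t) (fun t => C (b' t) * X ^ f' t) (fun t => C (b' (t - 1)) * X ^ f' (t - 1)) (k + j + 4))).det).eval (ρ' * z)) y' < 0 ∧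
    s' * (fun z : ℝ => (((ctPath (fun t => (X : ℝ[X]) ^ e' t) (fun t => C (b' t) * X ^ f' t) (fun t => C (b' (t - 1)) * X ^ f' (t - 1)) (k + j + 3))).det).eval (ρ' * z)) x₁' < 0 ∧
    (x₁' :: (R' ++ [M'])).IsChain (fun u v => (fun z : ℝ => (((ctPath (fun t => (X : ℝ[X]) ^ e' t) (fun t => C (b' t) * X ^ f' t) (fun t => C (b' (t - 1)) * X ^ f' (t - 1)) (k + j + 3))).det).eval (ρ' * z)) u * (fun z : ℝ => (((ctPath (fun t => (X : ℝ[X]) ^ e' t) (fun t => C (b' t) * X ^ f' t) (fun t => C (b' (t - 1)) * X ^ f' (t - 1)) (k + j + 3))).det).eval (ρ' * z)) v < 0) ∧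
    0 < μ' * (fun z : ℝ => (((ctPath (fun t => (X : ℝ[X]) ^ e' t) (fun t => C (b' t) * X ^ f' t) (fun t => C (b' (t - 1)) * X ^ f' (t - 1)) (k + j + 3))).det).eval (ρ' * z)) M' ∧
    (∀ t ∈ T', 0 < μ' * (fun z : ℝ => (((ctPath (fun t => (X : ℝ[X]) ^ e' t) (fun t => C (b' t) * X ^ f' t) (fun t => C (b' (t - 1)) * X ^ f' (t - 1)) (k + j + 3))).det).eval (ρ' * z)) t) ∧
    0 < μ' * (fun z : ℝ => (((ctPath (fun t => (X : ℝ[X]) ^ e' t) (fun t => C (b' t) * X ^ f' t) (fun t => C (b' (t - 1)) * X ^ f' (t - 1)) (k + j + 3))).det).eval (ρ' * z)) y' ∧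
    0 < μ' * (fun z : ℝ => (((ctPath (fun t => (X : ℝ[X]) ^ e' t) (fun t => C (b' t) * X ^ f' t) (fun t => C (b' (t - 1)) * X ^ f' (t - 1)) (k + j + 3))).det).eval (ρ' * z)) y₁' ∧
    μ' * (fun z : ℝ => (((ctPath (fun t => (X : ℝ[X]) ^ e' t) (fun t => C (b' t) * X ^ f' t) (fun t => C (b' (t - 1)) * X ^ f' (t - 1)) (k + j + 3))).det).eval (ρ' * z)) P1' < 0 ∧
    (∀ z ∈ Set.Icc P0' x₁', s' * (fun z : ℝ => (((ctPath (fun t => (X : ℝ[X]) ^ e' t) (fun t => C (b' t) * X ^ f' t) (fun t => C (b' (t - 1)) * X ^ f' (t - 1)) (k + j + 3))).det).eval (ρ' * z)) z < 0) ∧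
    (∀ z ∈ Set.Icc y' P1', μ' * (fun z : ℝ => (((ctPath (fun t => (X : ℝ[X]) ^ e' t) (fun t => C (b' t) * X ^ f' t) (fun t => C (b' (t - 1)) * X ^ f' (t - 1)) (k + j + 4))).det).eval (ρ' * z)) z < 0)) := by
  induction j with
  | zero =>
    exact ⟨e, b, f, ρ, s, μ, P0, x, x₁, R, M, T, y, y₁, P1, by simp, hμ, hρP0, hρP1, by omega,
      c1, c2a, c2b, c2c, c2d, c2e, c2f, c2g, c3c, c3d, c3e, c3f, c3g, c3h, c3i, c4, c5⟩
  | succ j ih =>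
    obtain ⟨e₁, b₁, f₁, ρ₁, s₁, μ₁, Q0, u, u₁, R₁, M₁, T₁, v, v₁, Q1, hρ₁, hμ₁, hQ0, hQ1, hlen₁,
      d1, d2a, d2b, d2c, d2d, d2e, d2f, d2g, d3c, d3d, d3e, d3f, d3g, d3h, d3i, d4, d5⟩ := ih
    have hρ₁' : ρ₁ = 1 ∨ ρ₁ = -1 := by
      rcases hρ with h | h <;> rcases neg_one_pow_eq_or ℝ j with hj | hj <;> simp [hρ₁, h, hj]
    obtain ⟨e₂, b₂, f₂, ρ₂, s₂, μ₂, Q0', u', u₁', R₂, M₂, T₂, v', v₁', Q1', hρ₂, hμ₂, hQ0', hQ1', hlen₂, H⟩ :=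
      pump_succ (k + j) (S + 2 * j) hρ₁' hμ₁ hQ0 hQ1 hlen₁ d1 d2a d2b d2c d2d d2e d2f d2g d3c d3d d3e d3f d3g d3h d3i d4 d5
    refine ⟨e₂, b₂, f₂, ρ₂, s₂, μ₂, Q0', u', u₁', R₂, M₂, T₂, v', v₁', Q1', ?_, hμ₂, hQ0', hQ1', by omega, H⟩
    rw [hρ₂, hρ₁, pow_succ]; ring

/-! ### The harvest from an arbitrary state -/

/-- **HARVEST FROM ANY STATE**: one more hierarchical edge switching at the junction `M` yields data of a static definite tridiagonal
`(k+5) × (k+5)` design and a strictly increasing list of at least `S + 3` positive points — at least `S + 4` in the orientation `ρ = 1`, where the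
junction carries a transition zero (`pump_harvest_pos₄`) — along which `D_{k+5}` alternates in sign. [mechanism: val-sym-lift-p3 g9's harvest;
folklore] -/
theorem harvest_of_state (k S : ℕ) {e : ℕ → ℕ} {b : ℕ → ℝ} {f : ℕ → ℕ} {ρ s μ P0 x x₁ : ℝ} {R : List ℝ} {M : ℝ} {T : List ℝ} {y y₁ P1 : ℝ}
    (hρ : ρ = 1 ∨ ρ = -1) (hμ : μ = -(ρ * s)) (hρP0 : 0 < ρ * P0) (hρP1 : 0 < ρ * P1) (hlen : R.length + T.length = S)
    (c1 : (P0 :: x :: x₁ :: (R ++ M :: (T ++ [y, y₁, P1]))).IsChain (· < ·))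
    (c2a : 0 < s * (fun z : ℝ => (((ctPath (fun t => (X : ℝ[X]) ^ e t) (fun t => C (b t) * X ^ f t) (fun t => C (b (t - 1)) * X ^ f (t - 1)) (k + 4))).det).eval (ρ * z)) P0)
    (c2b : s * (fun z : ℝ => (((ctPath (fun t => (X : ℝ[X]) ^ e t) (fun t => C (b t) * X ^ f t) (fun t => C (b (t - 1)) * X ^ f (t - 1)) (k + 4))).det).eval (ρ * z)) x < 0)
    (c2c : s * (fun z : ℝ => (((ctPath (fun t => (X : ℝ[X]) ^ e t) (fun t => C (b t) * X ^ f t) (fun t => C (b (t - 1)) * X ^ f (t - 1)) (k + 4))).det).eval (ρ * z)) x₁ < 0)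
    (c2d : (∀ r ∈ R, s * (fun z : ℝ => (((ctPath (fun t => (X : ℝ[X]) ^ e t) (fun t => C (b t) * X ^ f t) (fun t => C (b (t - 1)) * X ^ f (t - 1)) (k + 4))).det).eval (ρ * z)) r < 0))
    (c2e : s * (fun z : ℝ => (((ctPath (fun t => (X : ℝ[X]) ^ e t) (fun t => C (b t) * X ^ f t) (fun t => C (b (t - 1)) * X ^ f (t - 1)) (k + 4))).det).eval (ρ * z)) M < 0)
    (c2f : (M :: (T ++ [y])).IsChain (fun u v => (fun z : ℝ => (((ctPath (fun t => (X : ℝ[X]) ^ e t) (fun t => C (b t) * X ^ f t) (fun t => C (b (t - 1)) * X ^ f (t - 1)) (k + 4))).det).eval (ρ * z)) u * (fun z : ℝ => (((ctPath (fun t => (X : ℝ[X]) ^ e t) (fun t => C (b t) * X ^ f t) (fun t => C (b (t - 1)) * X ^ f (t - 1)) (k + 4))).det).eval (ρ * z)) v < 0))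
    (c2g : μ * (fun z : ℝ => (((ctPath (fun t => (X : ℝ[X]) ^ e t) (fun t => C (b t) * X ^ f t) (fun t => C (b (t - 1)) * X ^ f (t - 1)) (k + 4))).det).eval (ρ * z)) y < 0)
    (c3c : s * (fun z : ℝ => (((ctPath (fun t => (X : ℝ[X]) ^ e t) (fun t => C (b t) * X ^ f t) (fun t => C (b (t - 1)) * X ^ f (t - 1)) (k + 3))).det).eval (ρ * z)) x₁ < 0)
    (c3d : (x₁ :: (R ++ [M])).IsChain (fun u v => (fun z : ℝ => (((ctPath (fun t => (X : ℝ[X]) ^ e t) (fun t => C (b t) * X ^ f t) (fun t => C (b (t - 1)) * X ^ f (t - 1)) (k + 3))).det).eval (ρ * z)) u * (fun z : ℝ => (((ctPath (fun t => (X : ℝ[X]) ^ e t) (fun t => C (b t) * X ^ f t) (fun t => C (b (t - 1)) * X ^ f (t - 1)) (k + 3))).det).eval (ρ * z)) v < 0))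
    (c3e : 0 < μ * (fun z : ℝ => (((ctPath (fun t => (X : ℝ[X]) ^ e t) (fun t => C (b t) * X ^ f t) (fun t => C (b (t - 1)) * X ^ f (t - 1)) (k + 3))).det).eval (ρ * z)) M)
    (c3f : (∀ t ∈ T, 0 < μ * (fun z : ℝ => (((ctPath (fun t => (X : ℝ[X]) ^ e t) (fun t => C (b t) * X ^ f t) (fun t => C (b (t - 1)) * X ^ f (t - 1)) (k + 3))).det).eval (ρ * z)) t))
    (c3g : 0 < μ * (fun z : ℝ => (((ctPath (fun t => (X : ℝ[X]) ^ e t) (fun t => C (b t) * X ^ f t) (fun t => C (b (t - 1)) * X ^ f (t - 1)) (k + 3))).det).eval (ρ * z)) y)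
    (c3h : 0 < μ * (fun z : ℝ => (((ctPath (fun t => (X : ℝ[X]) ^ e t) (fun t => C (b t) * X ^ f t) (fun t => C (b (t - 1)) * X ^ f (t - 1)) (k + 3))).det).eval (ρ * z)) y₁)
    (c3i : μ * (fun z : ℝ => (((ctPath (fun t => (X : ℝ[X]) ^ e t) (fun t => C (b t) * X ^ f t) (fun t => C (b (t - 1)) * X ^ f (t - 1)) (k + 3))).det).eval (ρ * z)) P1 < 0)
    (c4 : (∀ z ∈ Set.Icc P0 x₁, s * (fun z : ℝ => (((ctPath (fun t => (X : ℝ[X]) ^ e t) (fun t => C (b t) * X ^ f t) (fun t => C (b (t - 1)) * X ^ f (t - 1)) (k + 3))).det).eval (ρ * z)) z < 0))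
    (c5 : (∀ z ∈ Set.Icc y P1, μ * (fun z : ℝ => (((ctPath (fun t => (X : ℝ[X]) ^ e t) (fun t => C (b t) * X ^ f t) (fun t => C (b (t - 1)) * X ^ f (t - 1)) (k + 4))).det).eval (ρ * z)) z < 0)) :
    ∃ (e' : ℕ → ℕ) (b' : ℕ → ℝ) (f' : ℕ → ℕ) (Λ : List ℝ),
      Λ.IsChain (· < ·) ∧ (∀ u ∈ Λ, 0 < u) ∧ S + 3 ≤ Λ.length ∧ (ρ = 1 → S + 4 ≤ Λ.length) ∧
      Λ.IsChain (fun u v => (((ctPath (fun t => (X : ℝ[X]) ^ e' t) (fun t => C (b' t) * X ^ f' t) (fun t => C (b' (t - 1)) * X ^ f' (t - 1)) (k + 5))).det).eval u * (((ctPath (fun t => (X : ℝ[X]) ^ e' t) (fun t => C (b' t) * X ^ f' t) (fun t => C (b' (t - 1)) * X ^ f' (t - 1)) (k + 5))).det).eval v < 0) := by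
  rcases hρ with rfl | rfl
  · obtain ⟨e', b', f', Λ, h1, h2, h3, h4⟩ := pump_harvest_pos₄ k (by rw [hμ]; ring) (by linarith)
      c1 c2e c2f c2g c3c c3d c3e c4 c5
    exact ⟨e', b', f', Λ, h1, h2, by omega, fun _ => by omega, h4⟩
  · obtain ⟨e', b', f', Λ, h1, h2, h3, h4⟩ := pump_harvest_neg k (by rw [hμ]; ring) (by linarith)
      c1 c2e c2f c2g c3c c3d c3e c4 c5
    exact ⟨e', b', f', Λ, h1, h2, by omega, fun h => by norm_num at h, h4⟩

end Summit.ValiantsHypothesis.ValiantsHypothesis.Theorems.KPlusLogSqLaw.StaticTridiagonalRealLadder
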